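import Literature.Computability.AlgebraicComplexity.MS21SigmaPiOrbitsProofs
import Mathlib.RingTheory.Localization.Integer
import HarnessLib

/-!
# Medini–Shpilka 2021, Thm 42 (closures): `cl T^{GLaff}(F) = cl ΣΠ^{GLaff}(F) = cl ΣΠΣ(F)` — proofs

Discharge of the named fact `MS2021_thm_42_closure` of
`Literature/Computability/AlgebraicComplexity/MS21DenseOrbitsHittingSets.lean` (cell `val-lit`,
seat t20; board item X6-thm42-closure): `theorem MS2021_thm_42_closure_holds : MS2021_thm_42_closure`
— the orbits of the diagonal tensors `T_{s,d}` are DENSE in `ΣΠΣ` (closure of Def 9, through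
`F(ε) = RatFunc F`), for EVERY field `F`.

## The printed proof and what is typed here

Medini–Shpilka (CCC 2021 = arXiv:2102.05632, §6 "Proof of Theorem 1.26", arXiv p0034:L5-L6):
"The claim regarding the closures follows immediately from the fact that every matrix can be
approximated by invertible matrices and from the simple observation that for any `n`-variate
polynomial `f ∈ Σ^{[s]}Π^{[d]}Σ(F)`, there exist `A ∈ F^{n×n}`, `b ∈ F^n` such that
`T_{s,d}(Ax + b) = f(x)`." This gives `ΣΠΣ(F) ⊆ cl T^{GLaff}(F)`. The typed statement (Def 9 as
typed: `MS2021.closure`, classes evaluated at `F(ε)`) asks for `cl ΣΠΣ(F) ⊆ cl T^{GLaff}(F)`, i.e.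
the `F(ε)`-approximant `g_{m(n)} = ∑_{i<S} ∏_{j<D} L_{ij} ∈ Σ^{[S]}Π^{[D]}Σ(F(ε))` of `f_n` has affine
forms `L_{ij}` with ARBITRARY rational-function coefficients (only the coefficients of the OUTPUT
`g_{m(n)}` are in `F[ε]`). The same one-line idea works after clearing denominators, and this is
the argument formalised here (architecture, in the order of the file):

* `MS2021.isEpsApprox_of_eq_map` / `IsEpsApprox.exists_eq_map`: `g = f + O(ε)` (Def 9 eq. (1),
  `MS2021.IsEpsApprox`) iff `g` is the image of some `G₀ ∈ F[ε][x]` whose coefficientwise constant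
  terms form `f`; hence stability under padding (`IsEpsApprox.rename_castLE`).
* `MS2021.HasLevel q k P` ("`q^k · P` has `F[ε]`-coefficients"), closed under `+, ×, ∑, ∏`; the
  affine forms have level `≤ 1` for a common denominator `q` of their coefficients
  (`IsLocalization.exist_integer_multiples_of_finite`), so a product of `≤ D` of them has level
  `≤ D`, and `η^t · Y · Q ∈ ε·F[ε][x]` for `η = ε·q^D`, `t ≥ 1` (`exists_eq_map_C_X_mul`).
* The substitution (`MS2021.tMatrix`): slot `(i,j)` of `T_{S,D}` ↦ `L_{ij}(x) + η·y_{ij}` with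
  FRESH variables `y_{ij}` — the block matrix `[[η·I, Λ],[0, I]]` on (slots ⊕ rest) × (`y` ⊕ `x`),
  transported to `Fin (M + S·D)`; it is invertible (`isUnit_det_tMatrix`, `det = ± η^{SD}`), which
  is the typed form of "every matrix can be approximated by invertible matrices".
* `MS2021.exists_mem_affOrbit_sdm_isEpsApprox` (core, per level): expanding
  `∏_j (η y_{ij} + L_{ij})` (`prod_mul_add_eq_add_sum` = `Finset.prod_add`) gives
  `T_{S,D}(Ax+b) = g_{m(n)} + ∑_i ∑_{J ≠ ∅} η^{|J|} y_{iJ} ∏_{j∉J} L_{ij} = f_n + O(ε)`.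
* Family level (`MS2021.closure_spsClass_subset_closure_tAffClass`): a strictly increasing
  p-bounded level function `m'(n) = n + n^c + c ≥ m(n) + S·D` (padding), the witness family being
  `0 ∈ T_{0,0}^{GLaff}` off the image of `m'` (`exists_family_extension`); the `⊆`-chain
  `cl T^{GLaff} ⊆ cl ΣΠ^{GLaff} ⊆ cl ΣΠΣ` is closure monotonicity (`closure_mono`) along the
  inclusions of `MS2021_thm_42_incl_holds` taken over `F(ε)`.

Deviation from print (disclosed): the fresh variables `y_{ij}` (so `m'(n) ≥ m(n) + S·D` rather than
`n` variables) replace the generic perturbation of a possibly singular `A`; no size statement of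
the theorem is affected (Def 9 allows any polynomially bounded number of variables).
No new definition of a notion, no new named fact (D-0026): the four `def`s (`HasLevel`, `rowEquiv`,
`colEquiv`, `tMatrix`) are proof-internal bookkeeping with bodies. No `instance`, no `notation`.
`VP ≠ VNP` is NOT proved and nothing here bears on it beyond discharging a typed literature
statement by name (LADDER-VALIANT V4, orbit-closure flavour of succinct generators: ideation).

## References
* [MediniShpilka2021] D. Medini, A. Shpilka, *Hitting sets and reconstruction for dense orbits in
  VP_e and ΣΠΣ circuits*, CCC 2021, LIPIcs 200:19, Thm 42 eq. (7) (p.19:14) = arXiv:2102.05632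
  Thm 1.26 (held text p0008:L74-L78); proof §6 (p0034:L5-L6); Def 9 (p.19:7 = p0005:L36-L42),
  Def 4 (p.19:6), Def 40 (p.19:13).
-/

noncomputable section

open MvPolynomial Matrix

namespace Literature.Computability.AlgebraicComplexity

namespace MS2021

/-! ### `IsEpsApprox` in terms of `MvPolynomial.map` -/

section EpsApprox

variable {K : Type*} [Field K] {n M : ℕ}

/-- `g = f + O(ε)` from a `K[ε]`-model: if `g` is the image of `G₀ ∈ K[ε][x_1..x_M]` and the
constant terms of the coefficients of `G₀` form `f` (padded), then `g` `ε`-approximates `f`.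
[cite: MediniShpilka2021, Def 9 eq. (1) (CCC p.19:7; arXiv ‹Def 1.5› p0005:L36-L42)] -/
theorem isEpsApprox_of_eq_map (f : MvPolynomial (Fin n) K) {g : MvPolynomial (Fin M) (RatFunc K)}
    (h : n ≤ M) (G₀ : MvPolynomial (Fin M) (Polynomial K))
    (hg : g = map (algebraMap (Polynomial K) (RatFunc K)) G₀)
    (hκ : map Polynomial.constantCoeff G₀ = rename (Fin.castLE h) f) : IsEpsApprox f g := by
  refine ⟨h, fun e => ⟨coeff e G₀, by rw [hg, coeff_map], ?_⟩⟩
  rw [← Polynomial.constantCoeff_apply, ← coeff_map, hκ]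

/-- Conversely, an `ε`-approximant `g = f + O(ε)` is the image of some `G₀ ∈ K[ε][x_1..x_M]` whose
coefficientwise constant terms form `f` (padded by zero).
[cite: MediniShpilka2021, Def 9 eq. (1) (CCC p.19:7; arXiv ‹Def 1.5› p0005:L36-L42)] -/
theorem IsEpsApprox.exists_eq_map {f : MvPolynomial (Fin n) K} {g : MvPolynomial (Fin M) (RatFunc K)}
    (hfg : IsEpsApprox f g) :
    ∃ (h : n ≤ M) (G₀ : MvPolynomial (Fin M) (Polynomial K)),
      g = map (algebraMap (Polynomial K) (RatFunc K)) G₀ ∧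
        map Polynomial.constantCoeff G₀ = rename (Fin.castLE h) f := by
  classical
  obtain ⟨h, H⟩ := hfg
  choose p hp hp0 using H
  refine ⟨h, ∑ e ∈ g.support, monomial e (p e), ?_, ?_⟩
  · rw [map_sum]
    conv_lhs => rw [g.as_sum]
    refine Finset.sum_congr rfl fun e _ => ?_
    rw [map_monomial, ← hp e]
  · rw [map_sum]
    ext e
    simp only [coeff_sum, map_monomial, coeff_monomial, Polynomial.constantCoeff_apply]
    rw [Finset.sum_ite_eq']
    split_ifs with he
    · exact hp0 e
    · -- outside the support of `g` the coefficient of `f` vanishes too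
      have h0 : coeff e g = 0 := by simpa [mem_support_iff] using he
      have hpe : p e = 0 := by
        apply RatFunc.algebraMap_injective K
        rw [← hp e, h0, map_zero]
      rw [← hp0 e, hpe, Polynomial.coeff_zero]

/-- `ε`-approximation is stable under padding with further variables.
[cite: MediniShpilka2021, Def 9 (CCC p.19:7; arXiv ‹Def 1.5› p0005:L36-L42)] -/
theorem IsEpsApprox.rename_castLE {f : MvPolynomial (Fin n) K} {g : MvPolynomial (Fin M) (RatFunc K)}
    (hfg : IsEpsApprox f g) {M' : ℕ} (hM : M ≤ M') :
    IsEpsApprox f (rename (Fin.castLE hM) g) := by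
  obtain ⟨h, G₀, hg, hκ⟩ := hfg.exists_eq_map
  refine isEpsApprox_of_eq_map f (h.trans hM) (rename (Fin.castLE hM) G₀) ?_ ?_
  · rw [hg, map_rename]
  · rw [map_rename, hκ, rename_rename]
    rfl

end EpsApprox

/-! ### Clearing denominators: the "level" of a polynomial with `K(ε)`-coefficients -/

section Level

variable {K : Type*} [Field K] {σ : Type*}

/-- `P` has **`q`-level `≤ k`**: `q^k · P` has coefficients in `K[ε]` (for a fixed nonzero
`q ∈ K[ε]` clearing denominators). [folklore] -/
private def HasLevel (q : Polynomial K) (k : ℕ) (P : MvPolynomial σ (RatFunc K)) : Prop :=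
  ∃ P₀ : MvPolynomial σ (Polynomial K),
    C (algebraMap (Polynomial K) (RatFunc K) (q ^ k)) * P =
      map (algebraMap (Polynomial K) (RatFunc K)) P₀

namespace HasLevel

variable {q : Polynomial K} {k l : ℕ} {P Q : MvPolynomial σ (RatFunc K)}

/-- `0` has every level. [folklore] -/
private theorem zero (q : Polynomial K) (k : ℕ) : HasLevel q k (0 : MvPolynomial σ (RatFunc K)) :=
  ⟨0, by rw [mul_zero, map_zero]⟩

/-- Levels are closed under addition. [folklore] -/
private theorem add (hP : HasLevel q k P) (hQ : HasLevel q k Q) : HasLevel q k (P + Q) := by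
  obtain ⟨P₀, hP⟩ := hP
  obtain ⟨Q₀, hQ⟩ := hQ
  exact ⟨P₀ + Q₀, by rw [mul_add, hP, hQ, map_add]⟩

/-- Levels add under multiplication. [folklore] -/
private theorem mul (hP : HasLevel q k P) (hQ : HasLevel q l Q) : HasLevel q (k + l) (P * Q) := by
  obtain ⟨P₀, hP⟩ := hP
  obtain ⟨Q₀, hQ⟩ := hQ
  refine ⟨P₀ * Q₀, ?_⟩
  rw [map_mul, ← hP, ← hQ, pow_add, map_mul, map_mul]
  ring

/-- Level `≤ k` implies level `≤ l` for `k ≤ l`. [folklore] -/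
private theorem mono (hP : HasLevel q k P) (hkl : k ≤ l) : HasLevel q l P := by
  obtain ⟨P₀, hP⟩ := hP
  refine ⟨C (q ^ (l - k)) * P₀, ?_⟩
  rw [map_mul, map_C, ← hP, ← mul_assoc, ← map_mul, ← map_mul, ← pow_add,
    Nat.sub_add_cancel hkl]

/-- Levels are closed under finite sums. [folklore] -/
private theorem sum {ι : Type*} (s : Finset ι) {P : ι → MvPolynomial σ (RatFunc K)}
    (h : ∀ i ∈ s, HasLevel q k (P i)) : HasLevel q k (∑ i ∈ s, P i) := by
  classical
  induction s using Finset.induction_on with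
  | empty => rw [Finset.sum_empty]; exact zero q k
  | insert a s ha ih =>
    rw [Finset.sum_insert ha]
    exact (h a (Finset.mem_insert_self a s)).add
      (ih fun i hi => h i (Finset.mem_insert_of_mem hi))

/-- A product of `|s|` factors of level `≤ 1` has level `≤ |s|`. [folklore] -/
private theorem prod {ι : Type*} (s : Finset ι) {P : ι → MvPolynomial σ (RatFunc K)}
    (h : ∀ i ∈ s, HasLevel q 1 (P i)) : HasLevel q s.card (∏ i ∈ s, P i) := by
  classical
  induction s using Finset.induction_on with
  | empty =>
    rw [Finset.prod_empty, Finset.card_empty]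
    exact ⟨1, by rw [pow_zero, map_one, C_1, one_mul, map_one]⟩
  | insert a s ha ih =>
    rw [Finset.prod_insert ha, Finset.card_insert_of_notMem ha, add_comm]
    exact (h a (Finset.mem_insert_self a s)).mul
      (ih fun i hi => h i (Finset.mem_insert_of_mem hi))

/-- Polynomials with `K[ε]`-coefficients have level `0` (indeed any level). [folklore] -/
private theorem of_map (P₀ : MvPolynomial σ (Polynomial K)) (k : ℕ) :
    HasLevel q k (map (algebraMap (Polynomial K) (RatFunc K)) P₀) :=
  ⟨C (q ^ k) * P₀, by rw [map_mul, map_C]⟩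

/-- Variables have every level. [folklore] -/
private theorem X (i : σ) (k : ℕ) : HasLevel q k (X i : MvPolynomial σ (RatFunc K)) := by
  simpa using of_map (q := q) (MvPolynomial.X i : MvPolynomial σ (Polynomial K)) k

/-- Multiplying by a variable keeps the level. [folklore] -/
private theorem mul_X (hP : HasLevel q k P) (i : σ) : HasLevel q k (P * MvPolynomial.X i) := by
  simpa using hP.mul (HasLevel.X i 0)

/-- A constant `a ∈ K(ε)` with `q · a ∈ K[ε]` has level `≤ 1`. [folklore] -/
private theorem C_of_isInteger {a : RatFunc K}
    (ha : IsLocalization.IsInteger (Polynomial K) (algebraMap (Polynomial K) (RatFunc K) q * a)) :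
    HasLevel q 1 (C a : MvPolynomial σ (RatFunc K)) := by
  obtain ⟨a₀, ha₀⟩ := ha
  refine ⟨C a₀, ?_⟩
  rw [map_C, pow_one, ← map_mul, ← ha₀]

end HasLevel

/-- **The extra terms are `O(ε)`**: if `Q` has `q`-level `≤ D` and `t ≥ 1`, then
`η^t · Y · Q` with `η = ε · q^D` and `Y` a polynomial with `K[ε]`-coefficients is `ε` times a
polynomial with `K[ε]`-coefficients. [folklore] -/
private theorem exists_eq_map_C_X_mul {q : Polynomial K} {D t : ℕ} (ht : 1 ≤ t)
    {Q : MvPolynomial σ (RatFunc K)} (hQ : HasLevel q D Q) (Y₀ : MvPolynomial σ (Polynomial K)) :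
    ∃ E : MvPolynomial σ (Polynomial K),
      C ((algebraMap (Polynomial K) (RatFunc K) Polynomial.X *
            algebraMap (Polynomial K) (RatFunc K) (q ^ D)) ^ t) *
          map (algebraMap (Polynomial K) (RatFunc K)) Y₀ * Q =
        map (algebraMap (Polynomial K) (RatFunc K)) (C Polynomial.X * E) := by
  obtain ⟨Q₀, hQ₀⟩ := hQ
  obtain ⟨t', rfl⟩ := Nat.exists_eq_add_of_le' ht
  refine ⟨C ((Polynomial.X * q ^ D) ^ t') * Y₀ * Q₀, ?_⟩
  rw [map_mul, map_mul, map_mul, map_C, map_C, ← hQ₀, ← map_mul, ← map_pow, pow_succ, map_mul,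
    map_mul, map_mul (algebraMap (Polynomial K) (RatFunc K)), map_pow]
  simp only [map_mul, map_pow]
  ring

end Level

/-! ### Expanding a product gate `∏_j (η · y_j + L_j)` -/

section ProdAdd

/-- `∏_j (c·Y_j + L_j) = ∏_j L_j + ∑_{J ≠ ∅} c^{|J|} · (∏_{j∈J} Y_j) · ∏_{j∉J} L_j`
(the binomial expansion of a product gate; `Finset.prod_add`). [folklore] -/
private theorem prod_mul_add_eq_add_sum {R : Type*} [CommSemiring R] {D : ℕ} (c : R) (Y L : Fin D → R) :
    ∏ j, (c * Y j + L j) =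
      (∏ j, L j) + ∑ J ∈ (Finset.univ : Finset (Fin D)).powerset.erase ∅,
        c ^ J.card * (∏ j ∈ J, Y j) * ∏ j ∈ Finset.univ \ J, L j := by
  classical
  rw [Finset.prod_add, ← Finset.add_sum_erase _ _ (Finset.empty_mem_powerset _)]
  congr 1
  · simp
  · refine Finset.sum_congr rfl fun J _ => ?_
    rw [Finset.prod_mul_distrib, Finset.prod_const]

end ProdAdd

/-! ### The matrix `[[Λ, η·I],[I, 0]]` of the printed substitution, made invertible -/

section TMatrix

variable {F : Type*} [Field F] {M E : ℕ}

/-- Rows of `Fin (M + E)`: the first `E` indices (the `T_{s,d}`-slots, `E = s·d`) and the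
remaining `M`. [folklore] -/
def rowEquiv (M E : ℕ) : Fin (M + E) ≃ Fin E ⊕ Fin M :=
  (finCongr (Nat.add_comm M E)).trans finSumFinEquiv.symm

/-- Columns of `Fin (M + E)`: the `x`-block (first `M` variables, `Sum.inr`) and the `y`-block
(last `E` variables, `Sum.inl`). [folklore] -/
def colEquiv (M E : ℕ) : Fin (M + E) ≃ Fin E ⊕ Fin M :=
  finSumFinEquiv.symm.trans (Equiv.sumComm (Fin M) (Fin E))

/-- The slot rows are the `Sum.inl` block. [folklore] -/
private theorem rowEquiv_castLE (r : Fin E) :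
    rowEquiv M E (Fin.castLE (Nat.le_add_left E M) r) = Sum.inl r := by
  have h : finCongr (Nat.add_comm M E) (Fin.castLE (Nat.le_add_left E M) r) = Fin.castAdd M r :=
    Fin.ext rfl
  simp only [rowEquiv, Equiv.trans_apply, h, finSumFinEquiv_symm_apply_castAdd]

/-- The `y`-variables are the `Sum.inl` column block. [folklore] -/
private theorem colEquiv_natAdd (r : Fin E) : colEquiv M E (Fin.natAdd M r) = Sum.inl r := by
  simp [colEquiv]

/-- The `x`-variables are the `Sum.inr` column block. [folklore] -/
private theorem colEquiv_castAdd (k : Fin M) : colEquiv M E (Fin.castAdd E k) = Sum.inr k := by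
  simp [colEquiv]

/-- The substitution matrix: block form `[[η·I_E, Λ],[0, I_M]]` on (slots ⊕ rest) × (`y`-block ⊕
`x`-block), transported to `Fin (M + E) × Fin (M + E)`; row `r < E` reads `Λ_r · x + η · y_r`.
[cite: MediniShpilka2021, §6 proof of Thm 42 (arXiv p0034:L6 "there exist A ∈ F^{n×n}, b ∈ F^n such that T_{s,d}(Ax+b) = f(x)", made invertible)] -/
def tMatrix (η : F) (Λ : Matrix (Fin E) (Fin M) F) : Matrix (Fin (M + E)) (Fin (M + E)) F :=
  Matrix.reindex (rowEquiv M E).symm (colEquiv M E).symm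
    (Matrix.fromBlocks (η • (1 : Matrix (Fin E) (Fin E) F)) Λ 0 1)

/-- Entries of the substitution matrix through the block form. [folklore] -/
private theorem tMatrix_apply (η : F) (Λ : Matrix (Fin E) (Fin M) F) (i j : Fin (M + E)) :
    tMatrix η Λ i j =
      Matrix.fromBlocks (η • (1 : Matrix (Fin E) (Fin E) F)) Λ 0 1
        (rowEquiv M E i) (colEquiv M E j) := by
  simp [tMatrix]

/-- Entry `(slot r, y_{r'})` of the substitution matrix is `η · [r = r']`. [folklore] -/
private theorem tMatrix_castLE_natAdd (η : F) (Λ : Matrix (Fin E) (Fin M) F) (r r' : Fin E) :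
    tMatrix η Λ (Fin.castLE (Nat.le_add_left E M) r) (Fin.natAdd M r') = if r = r' then η else 0 := by
  simp only [tMatrix_apply, rowEquiv_castLE, colEquiv_natAdd, Matrix.fromBlocks_apply₁₁,
    Matrix.smul_apply, Matrix.one_apply, smul_eq_mul, mul_ite, mul_one, mul_zero]

/-- Entry `(slot r, x_k)` of the substitution matrix is `Λ_{rk}`. [folklore] -/
private theorem tMatrix_castLE_castAdd (η : F) (Λ : Matrix (Fin E) (Fin M) F) (r : Fin E) (k : Fin M) :
    tMatrix η Λ (Fin.castLE (Nat.le_add_left E M) r) (Fin.castAdd E k) = Λ r k := by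
  simp only [tMatrix_apply, rowEquiv_castLE, colEquiv_castAdd, Matrix.fromBlocks_apply₁₂]

/-- `det [[η·I, Λ],[0, I]] = ± η^E ≠ 0`: the substitution is in `GLaff`. [folklore] -/
private theorem isUnit_det_tMatrix {η : F} (hη : η ≠ 0) (Λ : Matrix (Fin E) (Fin M) F) :
    IsUnit (tMatrix η Λ).det := by
  rw [tMatrix, Matrix.det_reindex, Matrix.det_fromBlocks_zero₂₁, Matrix.det_smul, Matrix.det_one,
    Matrix.det_one, mul_one, mul_one]
  refine IsUnit.mul ?_ (IsUnit.pow _ (isUnit_iff_ne_zero.mpr hη))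
  exact (Units.isUnit _).map (Int.castRingHom F)

/-- Row `r < E` of the substitution: `∑_c A_{rc} x_c = η · y_r + ∑_k Λ_{rk} x_k`. [folklore] -/
private theorem sum_tMatrix_castLE_mul_X (η : F) (Λ : Matrix (Fin E) (Fin M) F) (r : Fin E) :
    ∑ c : Fin (M + E), C (tMatrix η Λ (Fin.castLE (Nat.le_add_left E M) r) c) * X c =
      C η * X (Fin.natAdd M r) +
        ∑ k : Fin M, C (Λ r k) * (X (Fin.castAdd E k) : MvPolynomial (Fin (M + E)) F) := by
  classical
  rw [Fin.sum_univ_add, add_comm (C η * X (Fin.natAdd M r)) _]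
  simp only [tMatrix_castLE_castAdd, tMatrix_castLE_natAdd]
  congr 1
  rw [Finset.sum_eq_single r, if_pos rfl]
  · intro r' _ hr'
    rw [if_neg (Ne.symm hr'), C_0, zero_mul]
  · intro h
    exact absurd (Finset.mem_univ r) h

end TMatrix

/-! ### The per-level construction: `T_{S,D}(Ax + b) = f + O(ε)` in the `T_{S,D}`-orbit -/

section Core

variable {K : Type*} [Field K]

/-- **Core step of MS Thm 42 (closures).** If `G ∈ K(ε)[x_1..x_M]` is a `Σ^{[S]}Π^{[D]}Σ` circuit
over `K(ε)` (affine forms `L_{ij}` with ARBITRARY rational-function coefficients) and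
`G = f + O(ε)`, then some member of the orbit `T_{S,D}^{GLaff_{M+SD}(K(ε))}` is also `f + O(ε)`:
with `q` a common denominator of the coefficients of the `L_{ij}` and `η = ε·q^D`, substitute the
slot `(i,j)` of `T_{S,D}` by `L_{ij}(x) + η · y_{ij}` (fresh variables `y`), completing to an
invertible affine map; then `T_{S,D}(Ax+b) = G + ∑_i ∑_{J ≠ ∅} η^{|J|} y_{iJ} ∏_{j ∉ J} L_{ij}` and
every extra coefficient lies in `ε·K[ε]`. (The printed one-liner, arXiv p0034:L6, is the case
of `K`-coefficients: "every matrix can be approximated by invertible matrices" and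
"`T_{s,d}(Ax+b) = f(x)`".)
[cite: MediniShpilka2021, Thm 42 eq. (7) and §6 proof (CCC p.19:14; arXiv p0008:L74-L78, p0034:L5-L6)] -/
theorem exists_mem_affOrbit_sdm_isEpsApprox {n M S D : ℕ} (f : MvPolynomial (Fin n) K)
    {G : MvPolynomial (Fin M) (RatFunc K)} (hG : IsSPS S D G) (hfG : IsEpsApprox f G) :
    ∃ G' ∈ affOrbit (M + S * D) (sdm (RatFunc K) S D), IsEpsApprox f G' := by
  classical
  obtain ⟨α, rfl⟩ := hG
  obtain ⟨h, G₀, hG₀, hκ⟩ := hfG.exists_eq_map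
  -- a common denominator `q = b₀` of all coefficients of all the affine forms
  obtain ⟨b₀, hb₀⟩ := IsLocalization.exist_integer_multiples_of_finite
    (nonZeroDivisors (Polynomial K)) (fun p : Fin S × Fin D × Option (Fin M) => α p.1 p.2.1 p.2.2)
  have hq0 : (b₀ : Polynomial K) ≠ 0 := nonZeroDivisors.coe_ne_zero b₀
  have hint : ∀ i j o, IsLocalization.IsInteger (Polynomial K)
      (algebraMap (Polynomial K) (RatFunc K) b₀ * α i j o) := by
    intro i j o
    have := hb₀ (i, j, o)
    rwa [Algebra.smul_def] at this
  -- `η = ε · q^D`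
  obtain ⟨η, hηdef⟩ : ∃ η : RatFunc K, η = algebraMap (Polynomial K) (RatFunc K) Polynomial.X *
      algebraMap (Polynomial K) (RatFunc K) ((b₀ : Polynomial K) ^ D) := ⟨_, rfl⟩
  have hη0 : η ≠ 0 := by
    rw [hηdef]
    exact mul_ne_zero (RatFunc.algebraMap_ne_zero Polynomial.X_ne_zero)
      (RatFunc.algebraMap_ne_zero (pow_ne_zero D hq0))
  -- the substitution `(A, b)`
  let slot : Fin S × Fin D ≃ Fin (S * D) := finProdFinEquiv
  let Λ : Matrix (Fin (S * D)) (Fin M) (RatFunc K) :=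
    fun r k => α (slot.symm r).1 (slot.symm r).2 (some k)
  let A : Matrix (Fin (M + S * D)) (Fin (M + S * D)) (RatFunc K) := tMatrix η Λ
  let bv : Fin (M + S * D) → RatFunc K := fun r =>
    Sum.elim (fun r' => α (slot.symm r').1 (slot.symm r').2 none) (fun _ => 0) (rowEquiv M (S * D) r)
  have hE : S * D ≤ M + S * D := Nat.le_add_left (S * D) M
  refine ⟨affSubst hE A bv (sdm (RatFunc K) S D), ⟨hE, A, bv, isUnit_det_tMatrix hη0 Λ, rfl⟩, ?_⟩
  -- the affine forms `L_{ij}` (in the `x`-block) and the fresh variables `y_{ij}`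
  let L : Fin S → Fin D → MvPolynomial (Fin (M + S * D)) (RatFunc K) := fun i j =>
    C (α i j none) + ∑ k : Fin M, C (α i j (some k)) * X (Fin.castAdd (S * D) k)
  let Y₀ : Fin S → Fin D → MvPolynomial (Fin (M + S * D)) (Polynomial K) := fun i j =>
    X (Fin.natAdd M (slot (i, j)))
  have hslot : ∀ i j, affSubst hE A bv (X (slot (i, j))) =
      C η * map (algebraMap (Polynomial K) (RatFunc K)) (Y₀ i j) + L i j := by
    intro i j
    simp only [affSubst, aeval_X, A, sum_tMatrix_castLE_mul_X, bv, rowEquiv_castLE, Sum.elim_inl,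
      Λ, Equiv.symm_apply_apply, Y₀, map_X, L]
    ring
  have hsubst : affSubst hE A bv (sdm (RatFunc K) S D) =
      ∑ i, ∏ j, (C η * map (algebraMap (Polynomial K) (RatFunc K)) (Y₀ i j) + L i j) := by
    show aeval _ (∑ i : Fin S, ∏ j : Fin D, X (finProdFinEquiv (i, j))) = _
    rw [map_sum]
    refine Finset.sum_congr rfl fun i _ => ?_
    rw [map_prod]
    exact Finset.prod_congr rfl fun j _ => hslot i j
  -- each `L_{ij}` has `q`-level `≤ 1`
  have hL : ∀ i j, HasLevel (b₀ : Polynomial K) 1 (L i j) := by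
    intro i j
    have h1 : HasLevel (b₀ : Polynomial K) 1 (C (α i j none) : MvPolynomial (Fin (M + S * D)) (RatFunc K)) :=
      HasLevel.C_of_isInteger (hint i j none)
    have h2 : ∀ k : Fin M, HasLevel (b₀ : Polynomial K) 1
        (C (α i j (some k)) * X (Fin.castAdd (S * D) k) : MvPolynomial (Fin (M + S * D)) (RatFunc K)) :=
      fun k => (HasLevel.C_of_isInteger (hint i j (some k))).mul_X _
    exact h1.add (HasLevel.sum Finset.univ fun k _ => h2 k)
  -- the extra terms are `ε · K[ε]`-polynomials
  have hextra : ∀ (i : Fin S) (J : Finset (Fin D)),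
      ∃ EJ : MvPolynomial (Fin (M + S * D)) (Polynomial K), 1 ≤ J.card →
        C η ^ J.card * (∏ j ∈ J, map (algebraMap (Polynomial K) (RatFunc K)) (Y₀ i j)) *
            ∏ j ∈ Finset.univ \ J, L i j =
          map (algebraMap (Polynomial K) (RatFunc K)) (C Polynomial.X * EJ) := by
    intro i J
    by_cases hJ : 1 ≤ J.card
    · have hQ : HasLevel (b₀ : Polynomial K) D (∏ j ∈ Finset.univ \ J, L i j) :=
        (HasLevel.prod _ fun j _ => hL i j).mono ((Finset.card_le_univ _).trans (by simp))
      obtain ⟨EJ, hEJ⟩ := exists_eq_map_C_X_mul hJ hQ (∏ j ∈ J, Y₀ i j)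
      refine ⟨EJ, fun _ => ?_⟩
      rw [← hEJ, map_prod, ← map_pow, hηdef]
    · exact ⟨0, fun h' => absurd h' hJ⟩
  choose EJ hEJ using hextra
  -- the `x`-part is `G` renamed into the `x`-block
  have hren : rename (Fin.castAdd (S * D))
      (∑ i : Fin S, ∏ j : Fin D, (C (α i j none) + ∑ k : Fin M, C (α i j (some k)) * X k)) =
        ∑ i, ∏ j, L i j := by
    simp only [map_sum, map_prod, map_add, map_mul, rename_C, rename_X, L]
  -- expansion of one product gate
  have hgate : ∀ i, ∏ j, (C η * map (algebraMap (Polynomial K) (RatFunc K)) (Y₀ i j) + L i j) =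
      (∏ j, L i j) + map (algebraMap (Polynomial K) (RatFunc K)) (C Polynomial.X *
        ∑ J ∈ (Finset.univ : Finset (Fin D)).powerset.erase ∅, EJ i J) := by
    intro i
    rw [prod_mul_add_eq_add_sum, Finset.mul_sum, map_sum]
    congr 1
    refine Finset.sum_congr rfl fun J hJ => ?_
    exact hEJ i J (Finset.card_pos.mpr (Finset.nonempty_of_ne_empty (Finset.ne_of_mem_erase hJ)))
  -- assemble
  have hmain : affSubst hE A bv (sdm (RatFunc K) S D) =
      map (algebraMap (Polynomial K) (RatFunc K)) (rename (Fin.castAdd (S * D)) G₀ +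
        C Polynomial.X * ∑ i, ∑ J ∈ (Finset.univ : Finset (Fin D)).powerset.erase ∅, EJ i J) := by
    rw [hsubst, map_add, map_rename, ← hG₀, hren, Finset.mul_sum, map_sum,
      ← Finset.sum_add_distrib]
    exact Finset.sum_congr rfl fun i _ => hgate i
  refine isEpsApprox_of_eq_map f (h.trans (Nat.le_add_right M (S * D))) _ hmain ?_
  rw [map_add, map_rename, hκ, rename_rename, map_mul, map_C, Polynomial.constantCoeff_apply,
    Polynomial.coeff_X_zero, C_0, zero_mul, add_zero]
  rfl

end Core

/-! ### Padding, family bookkeeping, closure monotonicity -/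

section Family

variable {K : Type*} [Field K]

/-- A `Σ^{[s]}Π^{[d]}Σ` circuit stays one after padding with unused variables (their
coefficients are `0`). [cite: MediniShpilka2021, Def 4 (CCC p.19:6; arXiv ‹Def 1.4› p0005:L25-L30)] -/
theorem IsSPS.rename_castLE {M M' s d : ℕ} {G : MvPolynomial (Fin M) K} (hG : IsSPS s d G)
    (h : M ≤ M') : IsSPS s d (rename (Fin.castLE h) G) := by
  classical
  obtain ⟨α, rfl⟩ := hG
  refine ⟨fun i j o => o.elim (α i j none) fun k' =>
    ∑ k : Fin M, if Fin.castLE h k = k' then α i j (some k) else 0, ?_⟩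
  simp only [map_sum, map_prod, map_add, map_mul, rename_C, rename_X, Option.elim]
  refine Finset.sum_congr rfl fun i _ => Finset.prod_congr rfl fun j _ => ?_
  congr 1
  simp only [Finset.sum_mul]
  rw [Finset.sum_comm]
  refine Finset.sum_congr rfl fun k _ => ?_
  simp only [apply_ite C, C_0, ite_mul, zero_mul, Finset.sum_ite_eq, Finset.mem_univ, if_true]

/-- A family of polynomials given at the levels `m' n` of an injective `m'` extends to all levels
(by `0` elsewhere). [folklore] -/
private theorem exists_family_extension {R : Type*} [CommSemiring R] (m' : ℕ → ℕ)
    (hm' : Function.Injective m') (P : ∀ n, MvPolynomial (Fin (m' n)) R) :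
    ∃ g : ∀ N, MvPolynomial (Fin N) R,
      (∀ n, g (m' n) = P n) ∧ ∀ N, (∀ n, m' n ≠ N) → g N = 0 := by
  classical
  have key : ∀ {a b : ℕ} (_ : a = b) (e' : m' a = m' b), rename (Fin.cast e') (P a) = P b := by
    intro a b e e'
    subst e
    have hid : Fin.cast e' = id := funext fun i => Fin.ext rfl
    rw [hid]
    exact rename_id_apply _
  refine ⟨fun N => if hN : ∃ n, m' n = N then rename (Fin.cast hN.choose_spec) (P hN.choose) else 0,
    fun n => ?_, fun N hN => ?_⟩
  · have hN : ∃ n', m' n' = m' n := ⟨n, rfl⟩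
    dsimp only
    rw [dif_pos hN]
    exact key (hm' hN.choose_spec) hN.choose_spec
  · dsimp only
    rw [dif_neg (not_exists.mpr hN)]

/-- Closure (Def 9) is monotone in the class. [cite: MediniShpilka2021, Def 9 (CCC p.19:7; arXiv ‹Def 1.5› p0005:L36-L42)] -/
theorem closure_mono {𝒞 𝒟 : Set (∀ n, MvPolynomial (Fin n) (RatFunc K))} (h : 𝒞 ⊆ 𝒟) :
    closure 𝒞 ⊆ closure 𝒟 := by
  rintro f ⟨m, hm, g, hg, hfg⟩
  exact ⟨m, hm, g, h hg, hfg⟩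

/-- `0 = T_{0,0}(1·x + 0)` lies in the `T_{0,0}`-orbit at every level. [cite: MediniShpilka2021, Def 40 (CCC p.19:13)] -/
theorem zero_mem_affOrbit_sdm_zero (N : ℕ) : (0 : MvPolynomial (Fin N) K) ∈ affOrbit N (sdm K 0 0) := by
  refine ⟨Nat.zero_le _, 1, 0, by simp, ?_⟩
  simp [sdm, affSubst]

end Family

end MS2021

/-! ### The discharge -/

section Discharge

open MS2021

/-- **`cl ΣΠΣ(K) ⊆ cl T^{GLaff}(K)` for every field `K`** (the density of diagonal-tensor orbits):
level by level `T_{S,D}(Ax+b) = g_{m(n)} + O(ε) = f_n + O(ε)` (`exists_mem_affOrbit_sdm_isEpsApprox`)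
after padding `g_{m(n)}` to a strictly increasing p-bounded level `m'(n) ≥ m(n) + S·D`; off the
image of `m'` the witness family is `0 ∈ T_{0,0}^{GLaff}`.
[cite: MediniShpilka2021, Thm 42 eq. (7) (CCC p.19:14; arXiv ‹Thm 1.26› p0008:L74-L78; proof §6 p0034:L5-L6)] -/
theorem MS2021.closure_spsClass_subset_closure_tAffClass (K : Type) [Field K] :
    closure (SPSClass (RatFunc K)) ⊆ closure (TAffClass (RatFunc K)) := by
  classical
  rintro f ⟨m, hm, g, ⟨s, d, hs, hd, hg⟩, hfg⟩
  -- a strictly increasing p-bounded level function dominating `m(n) + S·D`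
  obtain ⟨c, hc⟩ : IsPBounded fun n => m n + s (m n) * d (m n) :=
    IsPBounded.add_holds hm
      (IsPBounded.mul_holds (IsPBounded.comp_holds hs hm) (IsPBounded.comp_holds hd hm))
  let m' : ℕ → ℕ := fun n => n + (n ^ c + c)
  have hm'mono : StrictMono m' := fun a b hab => by
    show a + (a ^ c + c) < b + (b ^ c + c)
    have := Nat.pow_le_pow_left hab.le c
    omega
  have hm'pb : IsPBounded m' := IsPBounded.add_holds IsPBounded.id ⟨c, fun n => le_rfl⟩
  have hle : ∀ n, m n + s (m n) * d (m n) ≤ m' n := fun n => (hc n).trans (Nat.le_add_left _ _)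
  -- per level
  have key : ∀ n, ∃ G' ∈ affOrbit (m' n) (sdm (RatFunc K) (s (m n)) (d (m n))),
      IsEpsApprox (f n) G' := by
    intro n
    obtain ⟨t, ht⟩ := Nat.exists_eq_add_of_le (hle n)
    have hpadS : IsSPS (s (m n)) (d (m n)) (rename (Fin.castLE (Nat.le_add_right (m n) t)) (g (m n))) :=
      (hg (m n)).rename_castLE _
    have hpadA : IsEpsApprox (f n) (rename (Fin.castLE (Nat.le_add_right (m n) t)) (g (m n))) :=
      (hfg n).rename_castLE _
    have h3 := exists_mem_affOrbit_sdm_isEpsApprox (f n) hpadS hpadA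
    rw [ht, Nat.add_right_comm]
    exact h3
  choose G' hG'mem hG'app using key
  obtain ⟨g', hg'₁, hg'₂⟩ := exists_family_extension m' hm'mono.injective G'
  refine ⟨m', hm'pb, g', fun N => ?_, fun n => ?_⟩
  · by_cases hN : ∃ n, m' n = N
    · obtain ⟨n, rfl⟩ := hN
      refine ⟨s (m n), d (m n), le_trans (Nat.le_add_left _ _) (hle n), ?_⟩
      rw [hg'₁]
      exact hG'mem n
    · refine ⟨0, 0, Nat.zero_le _, ?_⟩
      rw [hg'₂ N (not_exists.mp hN)]
      exact zero_mem_affOrbit_sdm_zero N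
  · rw [hg'₁]
    exact hG'app n

/-- **MS Thm 42 (closures), discharged**: `cl T^{GLaff}(F) = cl ΣΠ^{GLaff}(F) = cl ΣΠΣ(F)` for every
field `F` — by closure monotonicity along the inclusions `T^{GLaff} ⊆ ΣΠ^{GLaff} ⊆ ΣΠΣ` over `F(ε)`
(`MS2021_thm_42_incl_holds`) and `cl ΣΠΣ ⊆ cl T^{GLaff}`.
[cite: MediniShpilka2021, Thm 42 eq. (7) (CCC 2021 LIPIcs 200:19, p.19:14; = arXiv:2102.05632 ‹Thm 1.26›, p0008:L74-L78; proof §6 p0034:L5-L6)] -/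
theorem MS2021_thm_42_closure_holds : MS2021_thm_42_closure := by
  intro K _
  have h1 := closure_mono (MS2021.tAffClass_subset_sigmaPiAffClass (RatFunc K))
  have h2 := closure_mono (MS2021.sigmaPiAffClass_subset_spsClass (RatFunc K))
  have h3 := MS2021.closure_spsClass_subset_closure_tAffClass K
  exact ⟨h1.antisymm (h2.trans h3), h2.antisymm (h3.trans h1)⟩

end Discharge

/-! ### Template version of the density step (appended for MS Thm 32: `ANF_Δ` in place of `T_{s,d}`)

The per-level construction above used only that `T_{S,D}` is a polynomial with constant
coefficients into which affine forms are substituted. The same argument, with the product gates of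
`T_{S,D}` replaced by the monomials of an arbitrary template `T ∈ K[u_1, …, u_E]` (factor slots
`(i, r)`, `r < d_i`, of a monomial `u^d`), gives the density step for EVERY orbit class defined by a
template — used for Medini–Shpilka Thm 32 eq. (6) (`cl VP_e ⊆ cl ANF^{GLaff}`, template `ANF_Δ`:
"whose leaf linear forms are then approximated by linearly independent ones", arXiv p0026:L17-L19). -/

namespace MS2021

section Template

variable {K : Type*} [Field K]

/-- `∏_{j∈s} (c·Y_j + L_j) = ∏_{j∈s} L_j + ∑_{∅ ≠ J ⊆ s} c^{|J|} · (∏_{j∈J} Y_j) · ∏_{j∈s∖J} L_j` over an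
arbitrary finset. [folklore] -/
private theorem prod_mul_add_eq_add_sum' {R : Type*} [CommSemiring R] {ι : Type*} [DecidableEq ι]
    (s : Finset ι) (c : R) (Y L : ι → R) :
    ∏ j ∈ s, (c * Y j + L j) =
      (∏ j ∈ s, L j) + ∑ J ∈ s.powerset.erase ∅,
        c ^ J.card * (∏ j ∈ J, Y j) * ∏ j ∈ s \ J, L j := by
  rw [Finset.prod_add, ← Finset.add_sum_erase _ _ (Finset.empty_mem_powerset _)]
  congr 1
  · simp
  · refine Finset.sum_congr rfl fun J _ => ?_
    rw [Finset.prod_mul_distrib, Finset.prod_const]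

/-- Evaluating a template monomial by monomial, each power `g_i^{d_i}` unrolled into its `d_i` factor
slots `(i, r)`. [folklore] -/
private theorem aeval_eq_sum_prod_sigma {R : Type*} [CommSemiring R] {A : Type*} [CommSemiring A]
    [Algebra R A] {E : ℕ} (g : Fin E → A) (T : MvPolynomial (Fin E) R) :
    aeval g T = ∑ d ∈ T.support, algebraMap R A (coeff d T) *
      ∏ p ∈ d.support.sigma (fun i => (Finset.univ : Finset (Fin (d i)))), g p.1 := by
  rw [aeval_def, eval₂_eq]
  refine Finset.sum_congr rfl fun d _ => ?_
  congr 1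
  rw [Finset.prod_sigma]
  refine Finset.prod_congr rfl fun i _ => ?_
  dsimp only
  rw [Finset.prod_const, Finset.card_univ, Fintype.card_fin]

/-- The number of factor slots of a monomial is its degree. [folklore] -/
private theorem card_sigma_univ_fin {E : ℕ} (d : Fin E →₀ ℕ) :
    (d.support.sigma (fun i => (Finset.univ : Finset (Fin (d i))))).card = d.sum fun _ e => e := by
  rw [Finset.card_sigma]
  simp only [Finset.card_univ, Fintype.card_fin]
  rfl

/-- **Density step for a template orbit class.** Let `T ∈ K[u_1..u_E]` (constant coefficients) and
let `G = T(ℓ_1(x), …, ℓ_E(x)) ∈ K(ε)[x_1..x_M]` for affine forms `ℓ_i` with ARBITRARY rational-function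
coefficients be an `ε`-approximant of `f`. Then some member of the orbit `T^{GLaff_{M+E}(K(ε))}` is
`f + O(ε)`: substitute `u_i ↦ ℓ_i(x) + η · y_i` (`η = ε·q^{deg T}`, `q` a common denominator), an
invertible affine map, and expand monomial by monomial — every extra term is `η^{|J|} y_J` times a
product of `≤ deg T` forms, hence in `ε·K[ε][x, y]`. (The `T_{s,d}` case is
`exists_mem_affOrbit_sdm_isEpsApprox`; for `T = ANF_Δ` this is the step "leaf linear forms are then
approximated by linearly independent ones" of MS Thm 32.)
[cite: MediniShpilka2021, Thm 32 eq. (6) and Thm 42 eq. (7), proofs (arXiv p0026:L17-L19, p0034:L5-L6)] -/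
theorem exists_mem_affOrbit_isEpsApprox_of_aeval {n M E : ℕ} (f : MvPolynomial (Fin n) K)
    (T : MvPolynomial (Fin E) K) (β : Fin E → Option (Fin M) → RatFunc K)
    (hfG : IsEpsApprox f (aeval (fun i => C (β i none) + ∑ k : Fin M, C (β i (some k)) * X k)
      (map (algebraMap K (RatFunc K)) T))) :
    ∃ G' ∈ affOrbit (M + E) (map (algebraMap K (RatFunc K)) T), IsEpsApprox f G' := by
  classical
  obtain ⟨h, G₀, hG₀, hκ⟩ := hfG.exists_eq_map
  -- a common denominator `q = b₀` of all coefficients of all the affine forms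
  obtain ⟨b₀, hb₀⟩ := IsLocalization.exist_integer_multiples_of_finite
    (nonZeroDivisors (Polynomial K)) (fun p : Fin E × Option (Fin M) => β p.1 p.2)
  have hq0 : (b₀ : Polynomial K) ≠ 0 := nonZeroDivisors.coe_ne_zero b₀
  have hint : ∀ i o, IsLocalization.IsInteger (Polynomial K)
      (algebraMap (Polynomial K) (RatFunc K) b₀ * β i o) := by
    intro i o
    have := hb₀ (i, o)
    rwa [Algebra.smul_def] at this
  -- `η = ε · q^D`, `D = deg T`
  obtain ⟨η, hηdef⟩ : ∃ η : RatFunc K, η = algebraMap (Polynomial K) (RatFunc K) Polynomial.X *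
      algebraMap (Polynomial K) (RatFunc K) ((b₀ : Polynomial K) ^ T.totalDegree) := ⟨_, rfl⟩
  have hη0 : η ≠ 0 := by
    rw [hηdef]
    exact mul_ne_zero (RatFunc.algebraMap_ne_zero Polynomial.X_ne_zero)
      (RatFunc.algebraMap_ne_zero (pow_ne_zero _ hq0))
  -- the coefficients of `T` seen in `K(ε)` are constants of `K[ε]`
  have hcoefT : ∀ d, algebraMap (RatFunc K) (MvPolynomial (Fin (M + E)) (RatFunc K))
      (coeff d (map (algebraMap K (RatFunc K)) T)) =
        map (algebraMap (Polynomial K) (RatFunc K)) (C (Polynomial.C (coeff d T))) := by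
    intro d
    rw [coeff_map, map_C, algebraMap_eq, IsScalarTower.algebraMap_apply K (Polynomial K) (RatFunc K),
      Polynomial.algebraMap_eq]
  -- the substitution `(A, b)`
  let Λ : Matrix (Fin E) (Fin M) (RatFunc K) := fun r k => β r (some k)
  let A : Matrix (Fin (M + E)) (Fin (M + E)) (RatFunc K) := tMatrix η Λ
  let bv : Fin (M + E) → RatFunc K := fun r =>
    Sum.elim (fun r' => β r' none) (fun _ => 0) (rowEquiv M E r)
  have hE : E ≤ M + E := Nat.le_add_left E M
  refine ⟨affSubst hE A bv (map (algebraMap K (RatFunc K)) T),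
    ⟨hE, A, bv, isUnit_det_tMatrix hη0 Λ, rfl⟩, ?_⟩
  -- the affine forms `ℓ_i` (in the `x`-block) and the fresh variables `y_i`
  let L : Fin E → MvPolynomial (Fin (M + E)) (RatFunc K) := fun i =>
    C (β i none) + ∑ k : Fin M, C (β i (some k)) * X (Fin.castAdd E k)
  let Y₀ : Fin E → MvPolynomial (Fin (M + E)) (Polynomial K) := fun i => X (Fin.natAdd M i)
  have hslot : ∀ i : Fin E, (∑ j : Fin (M + E), C (A (Fin.castLE hE i) j) * X j) + C (bv (Fin.castLE hE i)) =
      C η * map (algebraMap (Polynomial K) (RatFunc K)) (Y₀ i) + L i := by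
    intro i
    simp only [A, sum_tMatrix_castLE_mul_X, bv, rowEquiv_castLE, Sum.elim_inl, Λ, Y₀, map_X, L]
    ring
  have hsubst : affSubst hE A bv (map (algebraMap K (RatFunc K)) T) =
      aeval (fun i => C η * map (algebraMap (Polynomial K) (RatFunc K)) (Y₀ i) + L i)
        (map (algebraMap K (RatFunc K)) T) := by
    unfold affSubst
    exact congrArg (fun φ : Fin E → MvPolynomial (Fin (M + E)) (RatFunc K) =>
      aeval φ (map (algebraMap K (RatFunc K)) T)) (funext hslot)
  -- each `ℓ_i` has `q`-level `≤ 1`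
  have hL : ∀ i, HasLevel (b₀ : Polynomial K) 1 (L i) := by
    intro i
    have h1 : HasLevel (b₀ : Polynomial K) 1
        (C (β i none) : MvPolynomial (Fin (M + E)) (RatFunc K)) :=
      HasLevel.C_of_isInteger (hint i none)
    have h2 : ∀ k : Fin M, HasLevel (b₀ : Polynomial K) 1
        (C (β i (some k)) * X (Fin.castAdd E k) : MvPolynomial (Fin (M + E)) (RatFunc K)) :=
      fun k => (HasLevel.C_of_isInteger (hint i (some k))).mul_X _
    exact h1.add (HasLevel.sum Finset.univ fun k _ => h2 k)
  -- the extra terms are `ε · K[ε]`-polynomials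
  have hextra : ∀ (d : Fin E →₀ ℕ) (J : Finset ((i : Fin E) × Fin (d i))),
      ∃ EJ : MvPolynomial (Fin (M + E)) (Polynomial K),
        d ∈ (MvPolynomial.map (algebraMap K (RatFunc K)) T).support → 1 ≤ J.card →
          J ⊆ d.support.sigma (fun i => (Finset.univ : Finset (Fin (d i)))) →
          algebraMap (RatFunc K) (MvPolynomial (Fin (M + E)) (RatFunc K))
              (coeff d (map (algebraMap K (RatFunc K)) T)) *
            (C η ^ J.card * (∏ p ∈ J, map (algebraMap (Polynomial K) (RatFunc K)) (Y₀ p.1)) *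
              ∏ p ∈ d.support.sigma (fun i => (Finset.univ : Finset (Fin (d i)))) \ J, L p.1) =
            map (algebraMap (Polynomial K) (RatFunc K)) (C Polynomial.X * EJ) := by
    intro d J
    by_cases hd : d ∈ (MvPolynomial.map (algebraMap K (RatFunc K)) T).support
    · by_cases hJ : 1 ≤ J.card
      · have hdeg : (d.support.sigma (fun i => (Finset.univ : Finset (Fin (d i))))).card ≤
            T.totalDegree := by
          rw [card_sigma_univ_fin]
          exact le_totalDegree (support_map_subset _ _ hd)
        have hQ0 : HasLevel (b₀ : Polynomial K)
            (d.support.sigma (fun i => (Finset.univ : Finset (Fin (d i)))) \ J).card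
            (∏ p ∈ d.support.sigma (fun i => (Finset.univ : Finset (Fin (d i)))) \ J, L p.1) :=
          HasLevel.prod (d.support.sigma (fun i => (Finset.univ : Finset (Fin (d i)))) \ J)
            (fun p _ => hL p.1)
        have hcard : (d.support.sigma (fun i => (Finset.univ : Finset (Fin (d i)))) \ J).card ≤
            T.totalDegree :=
          (Finset.card_le_card Finset.sdiff_subset).trans hdeg
        have hQ := hQ0.mono hcard
        obtain ⟨EJ, hEJ⟩ := exists_eq_map_C_X_mul hJ hQ (∏ p ∈ J, Y₀ p.1)
        refine ⟨C (Polynomial.C (coeff d T)) * EJ, fun _ _ _ => ?_⟩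
        rw [hcoefT, ← map_pow, ← map_prod, hηdef, hEJ, ← map_mul, mul_left_comm]
      · exact ⟨0, fun _ h' => absurd h' hJ⟩
    · exact ⟨0, fun h' => absurd h' hd⟩
  choose EJ hEJ using hextra
  -- the `x`-part is `G` renamed into the `x`-block
  have hren : rename (Fin.castAdd E)
      (aeval (fun i => C (β i none) + ∑ k : Fin M, C (β i (some k)) * X k)
        (map (algebraMap K (RatFunc K)) T)) =
      aeval L (map (algebraMap K (RatFunc K)) T) := by
    rw [← AlgHom.comp_apply, comp_aeval]
    have hfun : (fun i => rename (Fin.castAdd E)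
        (C (β i none) + ∑ k : Fin M, C (β i (some k)) * X k : MvPolynomial (Fin M) (RatFunc K))) = L := by
      funext i
      simp only [map_add, map_sum, map_mul, rename_C, rename_X, L]
    exact congrArg (fun φ : Fin E → MvPolynomial (Fin (M + E)) (RatFunc K) =>
      aeval φ (map (algebraMap K (RatFunc K)) T)) hfun
  -- assemble
  have hmain : affSubst hE A bv (map (algebraMap K (RatFunc K)) T) =
      map (algebraMap (Polynomial K) (RatFunc K)) (rename (Fin.castAdd E) G₀ +
        C Polynomial.X * ∑ d ∈ (MvPolynomial.map (algebraMap K (RatFunc K)) T).support,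
          ∑ J ∈ (d.support.sigma (fun i => (Finset.univ : Finset (Fin (d i))))).powerset.erase ∅,
            EJ d J) := by
    rw [hsubst, aeval_eq_sum_prod_sigma, map_add, map_rename, ← hG₀, hren, aeval_eq_sum_prod_sigma,
      Finset.mul_sum, map_sum, ← Finset.sum_add_distrib]
    refine Finset.sum_congr rfl fun d hd => ?_
    rw [prod_mul_add_eq_add_sum', mul_add, Finset.mul_sum, Finset.mul_sum, map_sum]
    congr 1
    refine Finset.sum_congr rfl fun J hJ => ?_
    exact hEJ d J hd
      (Finset.card_pos.mpr (Finset.nonempty_of_ne_empty (Finset.ne_of_mem_erase hJ)))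
      (Finset.mem_powerset.mp (Finset.mem_of_mem_erase hJ))
  refine isEpsApprox_of_eq_map f (h.trans (Nat.le_add_right M E)) _ hmain ?_
  rw [map_add, map_rename, hκ, rename_rename, map_mul, map_C, Polynomial.constantCoeff_apply,
    Polynomial.coeff_X_zero, C_0, zero_mul, add_zero]
  rfl

end Template

end MS2021

end Literature.Computability.AlgebraicComplexity

end
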